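import Summits.ResolutionOfSingularities.ResolutionOfSingularities.Theorems.FrobeniusClosingSteerBetaLetterMonomial
import Mathlib.RingTheory.MvPolynomial.EulerIdentity
import HarnessLib

/-!
# Crux `Steer` (stmt-ResolutionOfSingularities-16345), chain W4.1, β-LEAF, K-β2♭ part (III), file G2a: three identities for binary forms
# used by the frame correction of the glue `yLetterLawHat_of` (def-free)

OURS (campaign `res-hironaka`, rung L ★L-G4, slot W4.1; statements about the route's own objects; they replace the
role of no printed item and are NOT statements of the manuscript under review [claim: Hironaka2017, status:
under-review]; AI review is weaker than expert review). Seat res-D-pv-003 (gen 7), K-β2♭ owner; GLUE (III) per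
res-L0-w41-plan-1 RULING 276(a).

* `eval_smul_of_isHomogeneous` — `Ψ(c·v) = c^n Ψ(v)` for `Ψ` homogeneous of degree `n`.
* `eval_add_smul_of_mul_self_eq_zero` — first-order Taylor expansion in a square-zero direction (two variables, any characteristic).
* `euler_eval` — Euler's identity evaluated at a point.
* `uPow_mem_maximalIdeal_pow`, `eval_mem_span_uPow_of_isHomogeneous` — monomial bookkeeping for binary forms in `(z, w)`.

[cite: CossartJannsenSaito2020, (7.4)] No Theses file is imported; nothing here is a route item or a registration.
-/

noncomputable section

-- `Summit.<S>.<S>.…` duplicates the summit name by design (single-problem summit).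
set_option linter.dupNamespace false

namespace Summit.ResolutionOfSingularities.ResolutionOfSingularities.Theorems.SwitchingDichotomy.BetaNewton

open IsLocalRing MvPolynomial
open Literature.AlgebraicGeometry.Resolution
open Literature.AlgebraicGeometry.Resolution.CossartPiltant (uPow uPow_mem_span_uPow)
open Summit.ResolutionOfSingularities.ResolutionOfSingularities.Theorems.SwitchingDichotomy.BetaLetter
  (uPow_four span_four_pow_eq_span_uPow)

variable {S : Type} [CommRing S]

/-! ## §1 Two algebraic identities for polynomials in two variables -/

/-- **A homogeneous polynomial evaluated at a scaled point.** [folklore] -/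
theorem eval_smul_of_isHomogeneous {σ : Type} {φ : MvPolynomial σ S} {n : ℕ} (hφ : φ.IsHomogeneous n) (c : S)
    (v : σ → S) : eval (c • v) φ = c ^ n * eval v φ := by
  classical
  conv_lhs => rw [φ.as_sum]
  conv_rhs => rw [φ.as_sum]
  rw [map_sum, map_sum, Finset.mul_sum]
  refine Finset.sum_congr rfl fun m hm => ?_
  rw [eval_monomial, eval_monomial]
  have hdeg : m.degree = n := by
    have := hφ (mem_support_iff.mp hm)
    rw [Finsupp.degree_eq_weight_one]; exact this
  simp only [Pi.smul_apply, smul_eq_mul, mul_pow]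
  rw [Finsupp.prod_mul]
  have : (m.prod fun _ e => c ^ e) = c ^ m.degree := by
    rw [Finsupp.prod, Finset.prod_pow_eq_pow_sum]; rfl
  rw [this, hdeg]; ring

/-- **First-order Taylor expansion in a square-zero direction** (two variables, any characteristic):
`Ψ(a + u·v) = Ψ(a) + u · (v₀ ∂₀Ψ(a) + v₁ ∂₁Ψ(a))` when `u² = 0`. [folklore] -/
theorem eval_add_smul_of_mul_self_eq_zero (φ : MvPolynomial (Fin 2) S) (a v : Fin 2 → S) {u : S} (hu : u * u = 0) :
    eval (a + u • v) φ = eval a φ + u * (v 0 * eval a (pderiv 0 φ) + v 1 * eval a (pderiv 1 φ)) := by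
  classical
  induction φ using MvPolynomial.induction_on with
  | C r => simp
  | add p q hp hq => simp only [map_add, hp, hq]; ring
  | mul_X p i hp =>
    have hX : ∀ k : Fin 2, pderiv k (X i : MvPolynomial (Fin 2) S) = if k = i then 1 else 0 := by
      intro k; by_cases h : k = i
      · subst h; simp
      · rw [if_neg h, pderiv_X_of_ne (Ne.symm h)]
    simp only [map_mul, eval_X, hp, Pi.add_apply, Pi.smul_apply, smul_eq_mul, Derivation.leibniz, smul_eq_mul,
      map_add, hX]
    obtain rfl | rfl : i = 0 ∨ i = 1 := by fin_cases i <;> simp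
    · simp
      linear_combination (v 0 * (v 0 * (eval a) ((pderiv 0) p) + v 1 * (eval a) ((pderiv 1) p))) * hu
    · simp
      linear_combination (v 1 * (v 0 * (eval a) ((pderiv 0) p) + v 1 * (eval a) ((pderiv 1) p))) * hu

/-- **Euler's identity, evaluated**: `v₀ ∂₀Ψ(v) + v₁ ∂₁Ψ(v) = d · Ψ(v)` for `Ψ` homogeneous of degree `d`. [folklore] -/
theorem euler_eval {Ψ : MvPolynomial (Fin 2) S} {d : ℕ} (hΨ : Ψ.IsHomogeneous d) (v : Fin 2 → S) :
    v 0 * eval v (pderiv 0 Ψ) + v 1 * eval v (pderiv 1 Ψ) = d * eval v Ψ := by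
  have := congrArg (eval v) hΨ.sum_X_mul_pderiv
  simpa [Fin.sum_univ_two, map_add, map_mul, eval_X, nsmul_eq_mul] using this

/-! ## §2 Monomial bookkeeping for binary forms -/

/-- A monomial `t^e` lies in `𝔪^|e|`. [folklore] -/
theorem uPow_mem_maximalIdeal_pow [IsLocalRing S] {x y z w : S} (hspan : Ideal.span {x, y, z, w} = maximalIdeal S)
    (e : Fin 4 → ℕ) : uPow ![x, y, z, w] e ∈ maximalIdeal S ^ (∑ l, e l) := by
  rw [← hspan, span_four_pow_eq_span_uPow]
  exact uPow_mem_span_uPow _ (by simp)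

/-- A binary form of degree `d` in `(z, w)` lies in the monomial ideal of the exponents with `d ≤ e₂ + e₃`. [folklore] -/
theorem eval_mem_span_uPow_of_isHomogeneous (x y z w : S) {d : ℕ} {Φ : MvPolynomial (Fin 2) S} (hΦ : Φ.IsHomogeneous d) :
    eval ![z, w] Φ ∈ Ideal.span (uPow ![x, y, z, w] '' {e | d ≤ e 2 + e 3}) := by
  classical
  rw [Φ.as_sum, map_sum]
  refine Ideal.sum_mem _ fun m hm => ?_
  rw [eval_monomial]
  refine Ideal.mul_mem_left _ _ ?_
  have hdeg : m.degree = d := by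
    have := hΦ (mem_support_iff.mp hm)
    rw [Finsupp.degree_eq_weight_one]; exact this
  have : (m.prod fun i e => (![z, w] : Fin 2 → S) i ^ e) = uPow ![x, y, z, w] ![0, 0, m 0, m 1] := by
    rw [uPow_four, Finsupp.prod_fintype _ _ (by simp), Fin.prod_univ_two]
    simp
  rw [this]
  refine uPow_mem_span_uPow _ ?_
  have hsum : m.degree = m 0 + m 1 := by rw [Finsupp.degree_eq_sum, Fin.sum_univ_two]
  simp only [Set.mem_setOf_eq, Matrix.cons_val]
  omega

end Summit.ResolutionOfSingularities.ResolutionOfSingularities.Theorems.SwitchingDichotomy.BetaNewton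

end
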